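import Summits.CriticalPhenomena.PercolationContinuityZ3.Theorems.PercNearOneGluingNoHeavyLowerTailSahiOneStepDefs
import HarnessLib

/-!
# One-step certificate, part 1/3: pivot identities for `T = E₃(1_H,·,·)` and `D` along a coordinate that `H` ignores

Support file (prover prim-ineq-prove-3 gen 14; `--supports stmt-CriticalPhenomena-4575`; memo `run/shared/lean/prim/prim-ineq-prove-3/FINDING-G14-ONESTEP-THRESHOLD.md`).
No definitions, no named facts, no sorries.  Generalises `…SahiCddPivot` from the OR event to any `H` with `DeterminedBy H ↑F`:
* `ind_insert_of_determinedBy`, `ind_sdiff_of_determinedBy` — `1_H(insert e ω) = 1_H(ω) = 1_H(ω ∖ e)` for `e ∉ F`;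
* `ex_indH_mul_mul_split`, `ex_indH_mul_split` — pivotal splitting of `E[1_H φ ψ]`, `E[1_H φ]`;
* `osT_pivot` — `T(φ,ψ) = p_e²T(φ¹,ψ¹) + q_e²T(φ⁰,ψ⁰) + p_eq_e[T(φ¹,ψ⁰) + T(φ⁰,ψ¹)] + p_eq_e·D((φ¹−φ⁰)(ψ¹−ψ⁰))`;
* `osD_pivot` — `D(h) = p_e D(h¹) + q_e D(h⁰)`.
-/

noncomputable section

namespace Summit.CriticalPhenomena.PercolationContinuityZ3.Theorems

namespace SahiOneStep

open Literature.Combinatorics.Sahi2008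
open Literature.Probability.Percolation (DeterminedBy determinedBy_iff)
open Literature.Probability.Percolation.DecisionTree (ind ind_of_mem ind_of_not_mem ind_nonneg)
open Literature.Probability.Percolation.BHK2006 (weight weight_nonneg blockFubini harris)
open Literature.Probability.LatticeModels (prodBernoulli sahiE3 sahiE3_def)
open SahiCdd (sec ex_congr' ex_lin2 ex_lin4 ex_split ex_mul_split sec_insert_of_not_mem sec_insert_insert
  sec_comp_insert sec_comp_sdiff sec_apply_insert sec_apply_sdiff monotone_sec dep_insert dep_sdiff ex_mul_le_ex_mul)

variable {ι : Type*} [Fintype ι] [DecidableEq ι]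

/-! ## Pivot identities along a coordinate that `H` ignores -/

omit [Fintype ι] [DecidableEq ι] in
/-- If `H` is determined by `F` and `e ∉ F`, membership in `H` is unaffected by inserting `e`. [folklore] -/
theorem ind_insert_of_determinedBy {H : Set (Set ι)} {F : Finset ι} (hH : DeterminedBy H (F : Set ι)) {e : ι}
    (he : e ∉ F) (ω : Set ι) : ind H (insert e ω) = ind H ω := by
  have hiff : insert e ω ∈ H ↔ ω ∈ H := by
    refine (determinedBy_iff H (F : Set ι)).1 hH (insert e ω) ω ?_
    ext i
    simp only [Set.mem_inter_iff, Set.mem_insert_iff, Finset.mem_coe]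
    constructor
    · rintro ⟨h | h, hi⟩
      · exact absurd (h ▸ hi) he
      · exact ⟨h, hi⟩
    · rintro ⟨h, hi⟩
      exact ⟨Or.inr h, hi⟩
  by_cases hω : ω ∈ H
  · rw [ind_of_mem hω, ind_of_mem (hiff.2 hω)]
  · rw [ind_of_not_mem hω, ind_of_not_mem (fun h => hω (hiff.1 h))]

omit [Fintype ι] [DecidableEq ι] in
/-- If `H` is determined by `F` and `e ∉ F`, membership in `H` is unaffected by deleting `e`. [folklore] -/
theorem ind_sdiff_of_determinedBy {H : Set (Set ι)} {F : Finset ι} (hH : DeterminedBy H (F : Set ι)) {e : ι}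
    (he : e ∉ F) (ω : Set ι) : ind H (ω \ {e}) = ind H ω := by
  have hiff : ω \ {e} ∈ H ↔ ω ∈ H := by
    refine (determinedBy_iff H (F : Set ι)).1 hH (ω \ {e}) ω ?_
    ext i
    simp only [Set.mem_inter_iff, Set.mem_sdiff, Set.mem_singleton_iff, Finset.mem_coe]
    constructor
    · rintro ⟨⟨h, -⟩, hi⟩
      exact ⟨h, hi⟩
    · rintro ⟨h, hi⟩
      exact ⟨⟨h, fun hie => he (hie ▸ hi)⟩, hi⟩
  by_cases hω : ω ∈ H
  · rw [ind_of_mem hω, ind_of_mem (hiff.2 hω)]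
  · rw [ind_of_not_mem hω, ind_of_not_mem (fun h => hω (hiff.1 h))]

/-- Splitting of `E[1_H·φ·ψ]` along `e ∉ F`. [this work] -/
theorem ex_indH_mul_mul_split (p : ι → unitInterval) {H : Set (Set ι)} {F : Finset ι}
    (hH : DeterminedBy H (F : Set ι)) {e : ι} (he : e ∉ F) (φ ψ : Set ι → ℝ) :
    ex (bernoulliWeight p) (ind H * φ * ψ) =
      (p e : ℝ) * ex (bernoulliWeight p) (ind H * (fun ω => φ (insert e ω)) * (fun ω => ψ (insert e ω))) +
        (1 - p e) * ex (bernoulliWeight p) (ind H * (fun ω => φ (ω \ {e})) * (fun ω => ψ (ω \ {e}))) := by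
  rw [ex_split p e]
  congr 2
  · exact ex_congr' fun ω => by simp only [Pi.mul_apply, ind_insert_of_determinedBy hH he]
  · exact ex_congr' fun ω => by simp only [Pi.mul_apply, ind_sdiff_of_determinedBy hH he]

/-- Splitting of `E[1_H·φ]` along `e ∉ F`. [this work] -/
theorem ex_indH_mul_split (p : ι → unitInterval) {H : Set (Set ι)} {F : Finset ι}
    (hH : DeterminedBy H (F : Set ι)) {e : ι} (he : e ∉ F) (φ : Set ι → ℝ) :
    ex (bernoulliWeight p) (ind H * φ) =
      (p e : ℝ) * ex (bernoulliWeight p) (ind H * (fun ω => φ (insert e ω))) +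
        (1 - p e) * ex (bernoulliWeight p) (ind H * (fun ω => φ (ω \ {e}))) := by
  rw [ex_split p e]
  congr 2
  · exact ex_congr' fun ω => by simp only [Pi.mul_apply, ind_insert_of_determinedBy hH he]
  · exact ex_congr' fun ω => by simp only [Pi.mul_apply, ind_sdiff_of_determinedBy hH he]

/-- **Pivot identity for `T`** along `e ∉ F` (`H` determined by `F`):
`T(φ,ψ) = p_e² T(φ¹,ψ¹) + q_e² T(φ⁰,ψ⁰) + p_e q_e [T(φ¹,ψ⁰) + T(φ⁰,ψ¹)] + p_e q_e·D((φ¹−φ⁰)(ψ¹−ψ⁰))`. [this work] -/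
theorem osT_pivot (p : ι → unitInterval) {H : Set (Set ι)} {F : Finset ι}
    (hH : DeterminedBy H (F : Set ι)) {e : ι} (he : e ∉ F) (φ ψ : Set ι → ℝ) :
    osT p H φ ψ =
      (p e : ℝ) ^ 2 * osT p H (fun ω => φ (insert e ω)) (fun ω => ψ (insert e ω))
      + (1 - p e) ^ 2 * osT p H (fun ω => φ (ω \ {e})) (fun ω => ψ (ω \ {e}))
      + (p e : ℝ) * (1 - p e) * (osT p H (fun ω => φ (insert e ω)) (fun ω => ψ (ω \ {e}))
          + osT p H (fun ω => φ (ω \ {e})) (fun ω => ψ (insert e ω)))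
      + (p e : ℝ) * (1 - p e) *
          osD p H (fun ω => (φ (insert e ω) - φ (ω \ {e})) * (ψ (insert e ω) - ψ (ω \ {e}))) := by
  have h3 := ex_indH_mul_mul_split p hH he φ ψ
  have h2f := ex_indH_mul_split p hH he φ
  have h2g := ex_indH_mul_split p hH he ψ
  have hfg := ex_mul_split p e φ ψ
  have hf := ex_split p e φ
  have hg := ex_split p e ψ
  have hD := osD_sub_mul_sub p H (fun ω => φ (insert e ω)) (fun ω => φ (ω \ {e}))
    (fun ω => ψ (insert e ω)) (fun ω => ψ (ω \ {e}))
  unfold osT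
  rw [h3, h2f, h2g, hfg, hf, hg, hD]
  ring

/-- **Pivot identity for `D`** along `e ∉ F`: `D(h) = p_e D(h¹) + q_e D(h⁰)`. [this work] -/
theorem osD_pivot (p : ι → unitInterval) {H : Set (Set ι)} {F : Finset ι}
    (hH : DeterminedBy H (F : Set ι)) {e : ι} (he : e ∉ F) (h : Set ι → ℝ) :
    osD p H h = (p e : ℝ) * osD p H (fun ω => h (insert e ω)) + (1 - p e) * osD p H (fun ω => h (ω \ {e})) := by
  rw [osD_eq, osD_eq, osD_eq, ex_indH_mul_split p hH he h, ex_split p e h]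
  ring

end SahiOneStep

end Summit.CriticalPhenomena.PercolationContinuityZ3.Theorems
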